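import Mathlib
import Literature.NumberTheory.LFunctions.Zhang2022.KnifeEdgeInvisibleTailBlock

/-!
# The smooth top-vanishing class at ANY length, I: the invisible tail with class constants (class lemmas)

Companion to `KnifeEdgeInvisibleTail.lean` (engine, p445477), `KnifeEdgeInvisibleTailFamily.lean`
(`KnifeEdgeInvisibleTail.tailInvisible`, p446031) and `KnifeEdgeDiscMeanFlat.lean`
(`KnifeEdgeDiscMeanFlat.discMeanFlat`, p446527).  Those three files state the invisible tail for ONE normalised
profile (`g` 1-Lipschitz, `‖g‖ ≤ 1`) and the flatness of the `Re 𝔠*·‖·‖²·Re ω`-weighted discrete mean between the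
TWO lengths `⌈P^{1+ε}⌉` and `⌈P^{1+δ}⌉`.  A class-level statement («every design whose long pieces are smooth
top-vanishing profiles of any length») consumes slightly more, all of it routine from the landed theorems; this file
supplies it, with NO new definition (the profile polynomial
`F_N(ψ,ρ) = Σ_{1 ≤ n < N} χψ(n) g(log n/log P) n^{−ρ}` and the discrete means are written out, exactly as in p446527):

* `tailInvisible_lipschitzOn` — p446031 / p455698 for a profile `K`-Lipschitz and bounded by `M` on the overhang
  region `[1, ∞)` ONLY (nothing assumed at or below the wall `z = 1`; constant `C·max(K,M)·P^{−ε/4}`): covers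
  `ι`-weighted sums of smooth pieces and the twisted pieces `g(z)e^{iπk(ν−z)}` of (2.23)–(2.25) (`(K + πkM)`-Lipschitz),
  glued to ANY in-class (`H¹`, not necessarily Lipschitz) piece below the wall;
* `tailInvisible_sampled` — at every sampled pair `(ψ, ρ) ∈ Skeleton.idx χ` (displayed HYPOTHESIS `Re ρ = ½`, Zhang's
  Prop. 2.2 output in the (A)-world, as in p446527; nothing here asserts it) and for ANY two lengths
  `⌈P^{1+ε}⌉ ≤ N₁ ≤ N₂ ≤ ⌈P^{1+δ}⌉`, the block `Σ_{N₁ ≤ n < N₂}` of the profile polynomial has norm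
  `≤ C·max(K,M)·P^{−3ε/16}`;
* `discCrossFlat_lengths` — hence every sesquilinear («cross», `Ξ₁*`/`𝔡`-type) discrete mean
  `Σ_i w_i F_{N}(i) b_i` with arbitrary complex weights is flat in the length:
  `‖Σ_i w_i (F_{N₂}(i) − F_{N₁}(i)) b_i‖ ≤ C·max(K,M)·P^{−3ε/16}·Σ_i ‖w_i‖‖b_i‖`;
* (in `KnifeEdgeSmoothClassFlat.lean`) `discMeanFlat_lengths`, `discMeanFlat_topVanishing` — p446527 for any two
  lengths / the full polynomial of a top-vanishing piece, same class constants.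

WHAT THIS IS NOT: a claim about Theorems 1–2 of arXiv:2211.02515, about Landau–Siegel zeros, or about Parity; these are
pointwise size statements about smooth-profile character polynomials and their deterministic consequences for weighted
finite sums (classical tools only: Pólya–Vinogradov + Abel, through p445477/p446031).
[cite: MontgomeryVaughan2007, Thm 9.18] [cite: Zhang2022LandauSiegel, §2 (2.14)–(2.20); §4 p. 8; §7 (7.2); §8 Lemma 8.1]
-/

namespace Literature.NumberTheory.LFunctions.Zhang2022.KnifeEdgeSmoothClass

open Finset NNReal
open Literature.NumberTheory.LFunctions.Zhang2022.KnifeEdgeInvisibleTail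

section Bookkeeping

open Skeleton

/-- `⌈exp L₀⌉ ≤ D` gives `L₀ ≤ 𝓛 = log D`. [folklore] -/
private theorem le_ell_of_ceil_exp_le {L₀ : ℝ} {D : ℕ} (hD : ⌈Real.exp L₀⌉₊ ≤ D) : L₀ ≤ ell D := by
  have h : Real.exp L₀ ≤ (D : ℝ) := (Nat.le_ceil _).trans (by exact_mod_cast hD)
  exact (Real.le_log_iff_exp_le (lt_of_lt_of_le (Real.exp_pos _) h)).mpr h

/-- A sampled zero `ρ ∈ 𝔷(ψ)` has `|Im ρ| ≤ 8t₀` (`|Im ρ − 2πt₀| < 𝓛₁ = 𝓛⁴⁰⁵ ≤ t₀ = 𝓛⁵¹⁹`, `2π + 1 < 8`).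
[cite: Zhang2022LandauSiegel, §2 (2.8), (2.14)] -/
private theorem abs_im_le_of_mem_zeroSet {D : ℕ} (x : Chr D) (hℓ1 : 1 ≤ ell D) {ρ : ℂ}
    (hρ : ρ ∈ zeroSet D x) : |ρ.im| ≤ 8 * t0 D := by
  have h1 : |ρ.im - 2 * Real.pi * t0 D| < ell1 D := hρ.2.1
  have h2 : ell1 D ≤ t0 D := by
    simp only [ell1, t0]; exact pow_le_pow_right₀ hℓ1 (by norm_num)
  have h3 : 0 ≤ t0 D := by simp only [t0]; positivity
  have hπ : Real.pi < 3.15 := Real.pi_lt_d2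
  have hπt : Real.pi * t0 D ≤ 3.15 * t0 D := mul_le_mul_of_nonneg_right hπ.le h3
  have hπt0 : 0 ≤ Real.pi * t0 D := mul_nonneg Real.pi_pos.le h3
  have h4 := abs_lt.mp h1
  rw [abs_le]; constructor <;> linarith

/-- `2 ≤ P^{ε/4}` once `𝓛 ≥ 4/ε` (`P = e^{𝓛⁹}`). [folklore] -/
private theorem two_le_bigP_rpow {D : ℕ} {ε : ℝ} (hε : 0 < ε) (hℓ1 : 1 ≤ ell D) (hℓ4ε : 4 / ε ≤ ell D) :
    (2 : ℝ) ≤ bigP D ^ (ε / 4) := by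
  have hℓ9 : ell D ≤ ell D ^ 9 := by
    calc ell D = ell D ^ 1 := (pow_one _).symm
      _ ≤ ell D ^ 9 := pow_le_pow_right₀ hℓ1 (by norm_num)
  have h1 : bigP D ^ (ε / 4) = Real.exp (ell D ^ 9 * (ε / 4)) := by rw [bigP, ← Real.exp_mul]
  have h2 : ell D ^ 9 * (ε / 4) + 1 ≤ Real.exp (ell D ^ 9 * (ε / 4)) := Real.add_one_le_exp _
  have h3 : 4 ≤ ε * ell D := by rwa [div_le_iff₀' hε] at hℓ4ε
  have h4 : ε * ell D ≤ ε * ell D ^ 9 := mul_le_mul_of_nonneg_left hℓ9 hε.le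
  rw [h1]; nlinarith

/-- The block `(⌈P^{1+ε}⌉ − 1, ·]` starts beyond `P^{1+3ε/4}` once `P^{ε/4} ≥ 2`. [folklore] -/
private theorem rpow_le_ceil_sub_one {P ε : ℝ} (hP : 0 < P) (hP1 : 1 ≤ P) (hε : 0 < ε) (h2 : 2 ≤ P ^ (ε / 4)) :
    P ^ (1 + 3 * ε / 4) ≤ ((⌈P ^ (1 + ε)⌉₊ - 1 : ℕ) : ℝ) := by
  have hN1 : 1 ≤ ⌈P ^ (1 + ε)⌉₊ := Nat.one_le_ceil_iff.mpr (Real.rpow_pos_of_pos hP _)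
  rw [Nat.cast_sub hN1, Nat.cast_one]
  have h1 : P ^ (1 + ε) ≤ (⌈P ^ (1 + ε)⌉₊ : ℝ) := Nat.le_ceil _
  have h2' : P ^ (1 + ε) = P ^ (1 + 3 * ε / 4) * P ^ (ε / 4) := by
    rw [← Real.rpow_add hP]; ring_nf
  have h3 : 1 ≤ P ^ (1 + 3 * ε / 4) := Real.one_le_rpow hP1 (by linarith)
  nlinarith

/-- Normalising a profile that is `K`-Lipschitz and bounded by `M` on a set `S`: for `c ≥ max(K, M)`, `c > 0`, the
profile `c⁻¹·g` is 1-Lipschitz and bounded by `1` on `S`. [folklore] -/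
private theorem lipschitzOn_normalise {g : ℝ → ℂ} {K : ℝ≥0} {M : ℝ} {S : Set ℝ} (hg : LipschitzOnWith K g S)
    (hM : ∀ z ∈ S, ‖g z‖ ≤ M) {c : ℝ} (hKc : (K : ℝ) ≤ c) (hMc : M ≤ c) (hc : 0 < c) :
    LipschitzOnWith 1 (fun z => ((c⁻¹ : ℝ) : ℂ) * g z) S ∧ ∀ z ∈ S, ‖((c⁻¹ : ℝ) : ℂ) * g z‖ ≤ 1 := by
  have hcinv : ‖((c⁻¹ : ℝ) : ℂ)‖ = c⁻¹ := by
    rw [Complex.norm_real, Real.norm_of_nonneg (inv_nonneg.mpr hc.le)]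
  refine ⟨lipschitzOnWith_iff_dist_le_mul.mpr fun a ha b hb => ?_, fun z hz => ?_⟩
  · rw [dist_eq_norm, ← mul_sub, norm_mul, hcinv, ← dist_eq_norm, NNReal.coe_one, one_mul]
    have h1 := lipschitzOnWith_iff_dist_le_mul.mp hg a ha b hb
    calc c⁻¹ * dist (g a) (g b) ≤ c⁻¹ * (K * dist a b) :=
          mul_le_mul_of_nonneg_left h1 (inv_nonneg.mpr hc.le)
      _ ≤ c⁻¹ * (c * dist a b) :=
          mul_le_mul_of_nonneg_left (mul_le_mul_of_nonneg_right hKc dist_nonneg) (inv_nonneg.mpr hc.le)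
      _ = dist a b := by field_simp
  · rw [norm_mul, hcinv]
    calc c⁻¹ * ‖g z‖ ≤ c⁻¹ * c := mul_le_mul_of_nonneg_left ((hM z hz).trans hMc) (inv_nonneg.mpr hc.le)
      _ = 1 := inv_mul_cancel₀ hc.ne'

end Bookkeeping

/-! ## 1. The invisible tail for a general smooth profile (Lipschitz constant `K`, bound `M`) -/

section Tail

open Skeleton

/-- **The invisible tail, class version** (p446031 `KnifeEdgeInvisibleTail.tailInvisible` / p455698
`tailInvisible_of_lipschitzOnWith` for a profile `g` that is `K`-Lipschitz with `‖g‖ ≤ M` on the OVERHANG REGION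
`[1, ∞)` only — no hypothesis at or below the wall `z = 1`; `0 < ε`, `0 < δ`): there is `C > 0` such that for all large
`D`, every primitive quadratic `χ (mod D)`, every member `x = (p, ψ)` of the family, every such `g`, every `s` with
`½ − 1/log P ≤ Re s ≤ 2`, `|Im s| ≤ 8t₀`, and every block `P^{1+ε} ≤ X ≤ Y ≤ P^{1+δ}`:
`‖Σ_{X<n≤Y} χψ(n) g(log n/log P) n^{−s}‖ ≤ C · max(K, M) · P^{−ε/4}` (scaling `g ↦ g/max(K,M)`).  The class is
linear: `ι`-weighted sums of smooth pieces and the twisted pieces `g(z)e^{iπk(ν−z)}` of (2.23)–(2.25) stay in it.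
[cite: MontgomeryVaughan2007, Thm 9.18] [cite: Zhang2022LandauSiegel, §4 p. 8; §7 (7.2)] -/
theorem tailInvisible_lipschitzOn {δ ε : ℝ} (hε : 0 < ε) (hδ : 0 < δ) :
    ∃ C : ℝ, 0 < C ∧ Skeleton.ForAllLarge fun D _ χ =>
      ∀ (x : Skeleton.Chr D) (g : ℝ → ℂ) (K : ℝ≥0) (M : ℝ), LipschitzOnWith K g (Set.Ici 1) →
          (∀ z : ℝ, 1 ≤ z → ‖g z‖ ≤ M) →
        ∀ s : ℂ, 1 / 2 - 1 / Real.log (Skeleton.bigP D) ≤ s.re → s.re ≤ 2 → |s.im| ≤ 8 * Skeleton.t0 D →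
          ∀ X Y : ℕ, Skeleton.bigP D ^ (1 + ε) ≤ (X : ℝ) → X ≤ Y → (Y : ℝ) ≤ Skeleton.bigP D ^ (1 + δ) →
            ‖∑ n ∈ Finset.Ioc X Y, Skeleton.pc χ x n * g (Real.log n / Real.log (Skeleton.bigP D)) *
                (n : ℂ) ^ (-s)‖ ≤ C * max (K : ℝ) M * Skeleton.bigP D ^ (-(ε / 4)) := by
  obtain ⟨C, hC, D₀, hT⟩ := tailInvisible_of_lipschitzOnWith hε hδ
  refine ⟨C, hC, max D₀ 3, ?_⟩
  intro D _ χ hD hquad hprim x g K M hg hM s hσ1 hσ2 hsim X Y hX hXY hY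
  have hT' := hT D χ (le_trans (le_max_left _ _) hD) hquad hprim
  have hD3 : (3 : ℝ) ≤ D := by exact_mod_cast le_trans (le_max_right _ _) hD
  have hℓ0 : 0 < ell D := Real.log_pos (by linarith)
  have hP : 0 < bigP D := Real.exp_pos _
  have hlogP : 0 < Real.log (bigP D) := by rw [bigP, Real.log_exp]; positivity
  have hIci : Set.Ici (1 + ε) ⊆ Set.Ici (1 : ℝ) := Set.Ici_subset_Ici.mpr (by linarith)
  set c : ℝ := max (K : ℝ) M with hcdef
  have hM0 : 0 ≤ M := (norm_nonneg _).trans (hM 1 le_rfl)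
  have hKc : (K : ℝ) ≤ c := le_max_left _ _
  have hMc : M ≤ c := le_max_right _ _
  rcases eq_or_lt_of_le (hM0.trans hMc) with hc0 | hc0
  · -- `c = 0`: the profile vanishes on `[1, ∞)`, hence on the block (`log n / log P ≥ 1 + ε` there)
    have hg0 : ∀ z : ℝ, 1 ≤ z → g z = 0 := fun z hz => by
      have h := (hM z hz).trans hMc
      rw [← hc0] at h
      exact norm_le_zero_iff.mp h
    have hzero : ∑ n ∈ Finset.Ioc X Y, Skeleton.pc χ x n * g (Real.log n / Real.log (Skeleton.bigP D)) *
        (n : ℂ) ^ (-s) = 0 := by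
      refine Finset.sum_eq_zero fun n hn => ?_
      have hnX : X < n := (Finset.mem_Ioc.mp hn).1
      have hPn : bigP D ^ (1 + ε) ≤ (n : ℝ) := hX.trans (by exact_mod_cast hnX.le)
      have hz : 1 + ε ≤ Real.log n / Real.log (bigP D) := by
        rw [le_div_iff₀ hlogP]
        calc (1 + ε) * Real.log (bigP D) = Real.log (bigP D ^ (1 + ε)) := (Real.log_rpow hP _).symm
          _ ≤ Real.log n := Real.log_le_log (Real.rpow_pos_of_pos hP _) hPn
      rw [hg0 _ (by linarith)]; ring
    rw [hzero, norm_zero, ← hc0]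
    simp
  · obtain ⟨hg1, hg1'⟩ := lipschitzOn_normalise hg (fun z hz => hM z (Set.mem_Ici.mp hz)) hKc hMc hc0
    have key := hT' x _ (hg1.mono hIci) (fun z hz => hg1' z (hIci (Set.mem_Ici.mpr hz)))
      s hσ1 hσ2 hsim X Y hX hXY hY
    have hcc : (c : ℂ) * ((c⁻¹ : ℝ) : ℂ) = 1 := by
      rw [Complex.ofReal_inv]; exact mul_inv_cancel₀ (by exact_mod_cast hc0.ne')
    have hsum : ∑ n ∈ Finset.Ioc X Y, Skeleton.pc χ x n * g (Real.log n / Real.log (Skeleton.bigP D)) *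
        (n : ℂ) ^ (-s) = (c : ℂ) * ∑ n ∈ Finset.Ioc X Y, Skeleton.pc χ x n *
          (((c⁻¹ : ℝ) : ℂ) * g (Real.log n / Real.log (Skeleton.bigP D))) * (n : ℂ) ^ (-s) := by
      rw [Finset.mul_sum]
      refine Finset.sum_congr rfl fun n _ => ?_
      calc Skeleton.pc χ x n * g (Real.log n / Real.log (Skeleton.bigP D)) * (n : ℂ) ^ (-s)
          = ((c : ℂ) * ((c⁻¹ : ℝ) : ℂ)) *
            (Skeleton.pc χ x n * g (Real.log n / Real.log (Skeleton.bigP D)) * (n : ℂ) ^ (-s)) := by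
            rw [hcc, one_mul]
        _ = _ := by ring
    rw [hsum, norm_mul, Complex.norm_real, Real.norm_of_nonneg hc0.le]
    calc c * ‖∑ n ∈ Finset.Ioc X Y, Skeleton.pc χ x n *
          (((c⁻¹ : ℝ) : ℂ) * g (Real.log n / Real.log (Skeleton.bigP D))) * (n : ℂ) ^ (-s)‖
        ≤ c * (C * Skeleton.bigP D ^ (-(ε / 4))) := mul_le_mul_of_nonneg_left key hc0.le
      _ = C * c * Skeleton.bigP D ^ (-(ε / 4)) := by ring

/-- **The invisible tail at the sampled pairs, any two lengths** (`0 < ε`, `0 < δ`): there is `C > 0` such that for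
all large `D` and every primitive quadratic `χ (mod D)`, IF every sampled zero has `Re ρ = ½` (displayed hypothesis,
Zhang's Prop. 2.2 output under (A); nothing here asserts it), then for every profile `g` that is `K`-Lipschitz with `‖g‖ ≤ M` on `[1, ∞)`,
every two lengths `⌈P^{1+ε}⌉ ≤ N₁ ≤ N₂ ≤ ⌈P^{1+δ}⌉` and every sampled pair `(ψ, ρ) ∈ idx χ`:
`‖Σ_{N₁ ≤ n < N₂} χψ(n) g(log n/log P) n^{−ρ}‖ ≤ C · max(K, M) · P^{−3ε/16}` (the block `[N₁, N₂) = (N₁−1, N₂−1]`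
starts beyond `P^{1+3ε/4}`; `|Im ρ| ≤ 2πt₀ + 𝓛₁ ≤ 8t₀`).
[cite: MontgomeryVaughan2007, Thm 9.18] [cite: Zhang2022LandauSiegel, §2 (2.14); §4 p. 8; §7 (7.2)] -/
theorem tailInvisible_sampled {δ ε : ℝ} (hε : 0 < ε) (hδ : 0 < δ) :
    ∃ C : ℝ, 0 < C ∧ Skeleton.ForAllLarge fun D _ χ =>
      (∀ i ∈ Skeleton.idx χ, (i.2).re = 1 / 2) →
        ∀ (g : ℝ → ℂ) (K : ℝ≥0) (M : ℝ), LipschitzOnWith K g (Set.Ici 1) →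
          (∀ z : ℝ, 1 ≤ z → ‖g z‖ ≤ M) →
          ∀ N₁ N₂ : ℕ, ⌈Skeleton.bigP D ^ (1 + ε)⌉₊ ≤ N₁ → N₁ ≤ N₂ → N₂ ≤ ⌈Skeleton.bigP D ^ (1 + δ)⌉₊ →
            ∀ i ∈ Skeleton.idx χ,
              ‖∑ n ∈ Finset.Ico N₁ N₂, Skeleton.pc χ i.1 n * g (Real.log n / Real.log (Skeleton.bigP D)) *
                  (n : ℂ) ^ (-i.2)‖ ≤ C * max (K : ℝ) M * Skeleton.bigP D ^ (-(3 * ε / 16)) := by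
  have hε' : 0 < 3 * ε / 4 := by linarith
  obtain ⟨C, hC, D₁, hT⟩ := tailInvisible_lipschitzOn hε' hδ
  refine ⟨C, hC, max D₁ ⌈Real.exp (max 1 (4 / ε))⌉₊, ?_⟩
  intro D _ χ hD hquad hprim hcrit g K M hg hM N₁ N₂ hN₁ hN₁₂ hN₂ i hi
  have hD₁ : D₁ ≤ D := le_trans (le_max_left _ _) hD
  have hT' := hT D χ hD₁ hquad hprim
  -- parameters
  have hℓ : max 1 (4 / ε) ≤ ell D := le_ell_of_ceil_exp_le (le_trans (le_max_right _ _) hD)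
  have hℓ1 : 1 ≤ ell D := le_trans (le_max_left _ _) hℓ
  have hℓ4ε : 4 / ε ≤ ell D := le_trans (le_max_right _ _) hℓ
  have hP : 0 < bigP D := Real.exp_pos _
  have hP1 : 1 ≤ bigP D := by rw [bigP]; exact Real.one_le_exp (by positivity)
  have hlogPpos : 0 < Real.log (bigP D) := by rw [bigP, Real.log_exp]; positivity
  -- the sampled zero
  have hi' : i.1 ∈ finsetOf (PsiOne χ) ∧ i.2 ∈ finsetOf (zeroSet D i.1) := by
    simpa only [idx, Finset.mem_sigma] using hi
  have hz : i.2 ∈ zeroSet D i.1 := mem_of_mem_finsetOf hi'.2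
  have hre : i.2.re = 1 / 2 := hcrit i hi
  have him : |i.2.im| ≤ 8 * t0 D := abs_im_le_of_mem_zeroSet i.1 hℓ1 hz
  have h1σ : 1 / 2 - 1 / Real.log (bigP D) ≤ i.2.re := by
    rw [hre]; have := one_div_pos.mpr hlogPpos; linarith
  have h2σ : i.2.re ≤ 2 := by rw [hre]; norm_num
  -- the block `[N₁, N₂) = (N₁ − 1, N₂ − 1]`
  have hNε1 : 1 ≤ ⌈bigP D ^ (1 + ε)⌉₊ := Nat.one_le_ceil_iff.mpr (Real.rpow_pos_of_pos hP _)
  have hN₁1 : 1 ≤ N₁ := le_trans hNε1 hN₁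
  have hN₂1 : 1 ≤ N₂ := le_trans hN₁1 hN₁₂
  have hXs : N₁ - 1 + 1 = N₁ := Nat.sub_add_cancel hN₁1
  have hYs : N₂ - 1 + 1 = N₂ := Nat.sub_add_cancel hN₂1
  have hXY : N₁ - 1 ≤ N₂ - 1 := Nat.sub_le_sub_right hN₁₂ 1
  have hXr : bigP D ^ (1 + 3 * ε / 4) ≤ ((N₁ - 1 : ℕ) : ℝ) := by
    refine le_trans (rpow_le_ceil_sub_one hP hP1 hε (two_le_bigP_rpow hε hℓ1 hℓ4ε)) ?_
    exact_mod_cast Nat.sub_le_sub_right hN₁ 1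
  have hYr : (((N₂ - 1 : ℕ)) : ℝ) ≤ bigP D ^ (1 + δ) := by
    have hNδ1 : 1 ≤ ⌈bigP D ^ (1 + δ)⌉₊ := Nat.one_le_ceil_iff.mpr (Real.rpow_pos_of_pos hP _)
    have h1 : (((N₂ - 1 : ℕ)) : ℝ) ≤ ((⌈bigP D ^ (1 + δ)⌉₊ - 1 : ℕ) : ℝ) := by
      exact_mod_cast Nat.sub_le_sub_right hN₂ 1
    refine h1.trans ?_
    rw [Nat.cast_sub hNδ1, Nat.cast_one]
    have := Nat.ceil_lt_add_one (Real.rpow_nonneg hP.le (1 + δ))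
    linarith
  have key := hT' i.1 g K M hg hM i.2 h1σ h2σ him (N₁ - 1) (N₂ - 1) hXr hXY hYr
  rw [← hXs, ← hYs, Finset.Ico_add_one_add_one_eq_Ioc]
  have hexp : -(3 * ε / 4 / 4) = -(3 * ε / 16) := by ring
  rw [hexp] at key
  exact key

/-- **Cross (sesquilinear) discrete means are flat in the length** (`0 < ε`, `0 < δ`): there is `C > 0` such that for
all large `D` and every primitive quadratic `χ (mod D)`, IF every sampled zero has `Re ρ = ½`, then for every
profile `g` that is `K`-Lipschitz with `‖g‖ ≤ M` on `[1, ∞)`, every two lengths `⌈P^{1+ε}⌉ ≤ N₁ ≤ N₂ ≤ ⌈P^{1+δ}⌉` and ALL complex weights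
`w, b` on the sampled pairs,
`‖Σ_{(ψ,ρ)} w · (F_{N₂}(ψ,ρ) − F_{N₁}(ψ,ρ)) · b‖ ≤ C · max(K, M) · P^{−3ε/16} · Σ_{(ψ,ρ)} ‖w‖‖b‖`, where
`F_N(ψ,ρ) = Σ_{1 ≤ n < N} χψ(n) g(log n/log P) n^{−ρ}`: the `Ξ₁*`/`𝔡`-type means `Σ 𝔠*·F·J̄·ω` of a long smooth piece
against any fixed companion see nothing of the piece beyond `P^{1+ε}`.
[cite: Zhang2022LandauSiegel, §2 (2.17)–(2.19); §8 Lemma 8.1] -/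
theorem discCrossFlat_lengths {δ ε : ℝ} (hε : 0 < ε) (hδ : 0 < δ) :
    ∃ C : ℝ, 0 < C ∧ Skeleton.ForAllLarge fun D _ χ =>
      (∀ i ∈ Skeleton.idx χ, (i.2).re = 1 / 2) →
        ∀ (g : ℝ → ℂ) (K : ℝ≥0) (M : ℝ), LipschitzOnWith K g (Set.Ici 1) →
          (∀ z : ℝ, 1 ≤ z → ‖g z‖ ≤ M) →
          ∀ N₁ N₂ : ℕ, ⌈Skeleton.bigP D ^ (1 + ε)⌉₊ ≤ N₁ → N₁ ≤ N₂ → N₂ ≤ ⌈Skeleton.bigP D ^ (1 + δ)⌉₊ →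
            ∀ w b : ((_ : Skeleton.Chr D) × ℂ) → ℂ,
              ‖∑ i ∈ Skeleton.idx χ, w i *
                  ((∑ n ∈ Finset.Ico 1 N₂, Skeleton.pc χ i.1 n * g (Real.log n / Real.log (Skeleton.bigP D)) *
                      (n : ℂ) ^ (-i.2)) -
                    (∑ n ∈ Finset.Ico 1 N₁, Skeleton.pc χ i.1 n * g (Real.log n / Real.log (Skeleton.bigP D)) *
                      (n : ℂ) ^ (-i.2))) * b i‖ ≤
                C * max (K : ℝ) M * Skeleton.bigP D ^ (-(3 * ε / 16)) *
                  ∑ i ∈ Skeleton.idx χ, ‖w i‖ * ‖b i‖ := by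
  obtain ⟨C, hC, D₀, hT⟩ := tailInvisible_sampled hε hδ
  refine ⟨C, hC, D₀, ?_⟩
  intro D _ χ hD hquad hprim hcrit g K M hg hM N₁ N₂ hN₁ hN₁₂ hN₂ w b
  have hT' := hT D χ hD hquad hprim hcrit g K M hg hM N₁ N₂ hN₁ hN₁₂ hN₂
  have hP : 0 < bigP D := Real.exp_pos _
  have hNε1 : 1 ≤ ⌈bigP D ^ (1 + ε)⌉₊ := Nat.one_le_ceil_iff.mpr (Real.rpow_pos_of_pos hP _)
  have hN₁1 : 1 ≤ N₁ := le_trans hNε1 hN₁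
  set τ : ℝ := C * max (K : ℝ) M * Skeleton.bigP D ^ (-(3 * ε / 16)) with hτdef
  have hsplit : ∀ i : ((_ : Chr D) × ℂ),
      (∑ n ∈ Finset.Ico 1 N₂, pc χ i.1 n * g (Real.log n / Real.log (bigP D)) * (n : ℂ) ^ (-i.2)) -
        (∑ n ∈ Finset.Ico 1 N₁, pc χ i.1 n * g (Real.log n / Real.log (bigP D)) * (n : ℂ) ^ (-i.2)) =
        ∑ n ∈ Finset.Ico N₁ N₂, pc χ i.1 n * g (Real.log n / Real.log (bigP D)) * (n : ℂ) ^ (-i.2) := by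
    intro i
    rw [← Finset.sum_Ico_consecutive _ hN₁1 hN₁₂]
    ring
  calc ‖∑ i ∈ Skeleton.idx χ, w i *
          ((∑ n ∈ Finset.Ico 1 N₂, Skeleton.pc χ i.1 n * g (Real.log n / Real.log (Skeleton.bigP D)) *
              (n : ℂ) ^ (-i.2)) -
            (∑ n ∈ Finset.Ico 1 N₁, Skeleton.pc χ i.1 n * g (Real.log n / Real.log (Skeleton.bigP D)) *
              (n : ℂ) ^ (-i.2))) * b i‖
      ≤ ∑ i ∈ Skeleton.idx χ, ‖w i *
          ((∑ n ∈ Finset.Ico 1 N₂, Skeleton.pc χ i.1 n * g (Real.log n / Real.log (Skeleton.bigP D)) *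
              (n : ℂ) ^ (-i.2)) -
            (∑ n ∈ Finset.Ico 1 N₁, Skeleton.pc χ i.1 n * g (Real.log n / Real.log (Skeleton.bigP D)) *
              (n : ℂ) ^ (-i.2))) * b i‖ := norm_sum_le _ _
    _ ≤ ∑ i ∈ Skeleton.idx χ, ‖w i‖ * τ * ‖b i‖ := by
        refine Finset.sum_le_sum fun i hi => ?_
        rw [norm_mul, norm_mul, hsplit i]
        exact mul_le_mul_of_nonneg_right
          (mul_le_mul_of_nonneg_left (hT' i hi) (norm_nonneg _)) (norm_nonneg _)
    _ = τ * ∑ i ∈ Skeleton.idx χ, ‖w i‖ * ‖b i‖ := by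
        rw [Finset.mul_sum]
        exact Finset.sum_congr rfl fun i _ => by ring

end Tail

end Literature.NumberTheory.LFunctions.Zhang2022.KnifeEdgeSmoothClass
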